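/- Copyright: the b2b-balaban cell (near-miss cell 7), T⁴-continuum fan-out; row NE7b ROUND-2 swarm, seat
t4-ne7b-formalise-leaf-08 (gen 8) (row S12 «ASSEMBLY», owner repair row S12j «THRESHOLD-PAID MULTIPLICITY» ∕ sub-row S12i;
own-initiative smallness-census item F-leaf08g8-1 under standing default (i)).  Released under the licence of the
surrounding project. -/
import Summits.QuantumFields.BalabanUV.T4Continuum.Support.HistoryFlowProfileLevel
import Summits.QuantumFields.BalabanUV.T4Continuum.Support.HistoryConstantsSlackT3b

/-!
# History flow: THE p₀-TH-ROOT LEVEL — the coupling window of the repaired END, quantified and widened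

Summits-side support leaf of the T⁴-continuum cell (rung (B)+1 on a FINITE torus only; NOT infinite volume, NOT the
mass gap, NOT the Clay statement; NOT a proof of the spine estimate NE7b).  Claim table
`t4/b2b-balaban-t4-ne7b-p1/LEAVES-NE7b.md`, beside row S12j piece (e) (`HistoryFlowProfileLevel`, leaf-05 gen 6) and the
pinned END of record `HistoryRealiseCellsRunPinnedT3bP.hybridNE7_of_realisedDomainsRun_pinnedT3bPD` (leaf-02 gen 9,
p224056), whose `ForSmallCouplings` threshold is `g₁ := min (min 1 e^{−irThresholdTLE∕2}) e^{−(x_Θ+1)∕2}` at the LINEAR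
level `x_Θ := max 1 (Θ ∕ (θ·C.A₀))` of `HistoryFlowProfileLevel.le_theta_mul_level` (which uses only `x ≤ x^{p₀}`).

WHY (smallness census; finding F-leaf08g8-1, leaf-08 gen 8).  `Θ` is row S6g′'s class-linear constant
`ΘJ(d,sS,θc) + 8·2^d·log(2d+1) ≥ 8·8710^d` (`HistoryConstantsSlackT3b.theta_floor`, leaf-08 gen 7) and `θ < ½·O.γ₀·O.A₁²`
(`hslack`), so the linear level is `x_Θ ≥ 8·8710^d ∕ (θ·C.A₀)` and the pinned threshold is
`g₁ ≤ exp (−(8·8710^d∕(θ·C.A₀) + 1)∕2)` — at `d = 4`, `exp (−(46 042 893 350 480 000∕(θ·A₀) + 1)∕2)`.  The Prop proved by the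
headline is unchanged by this (the threshold is ∃-bound inside `ForSmallCouplings`), but the census of the cell's OWN
smallness conditions should carry the window as pinned AND the cheapest window the same letters allow: the profile is
`p₀(g) = A₀·(log g⁻²)^{p₀}` with `p₀ ≥ 1` (`ThresholdOK.rq_lt`; print: «p₀ ≥ 5r», [B14] p. 246 — context only, nothing
asserted), so the level that pays `Θ ≤ θ·(A₀·x^{p₀})` WITHOUT SLACK is the p₀-TH ROOT
    `x_root := max 1 ((Θ ∕ (θ·A₀)) ^ (p₀⁻¹ : ℝ))`,
with `A₀·x_root^{p₀} = max (A₀) (Θ∕θ)`; the linear level overpays by the factor `(Θ∕(θ·A₀))^{p₀−1}` (§3) and its window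
is narrower: `x_root ≤ x_Θ`, i.e. `e^{−(x_Θ+1)∕2} ≤ e^{−(x_root+1)∕2}` (§1).

WHAT ([folklore] real arithmetic + compositions BY NAME with leaf-05 gen 6's `hP_of_window` ∕ `hP_of_coupling`; no `def`,
no `[cite:]` tag, no `Prop` fact minted (c1); constants symbolic (c2∕c6) — `d = 4` is the summit's dimension, no other
numeral is substituted for a symbolic constant):
* §1 the root level: `one_le_rootLevel`, `rootLevel_nonneg`, `rootLevel_eq_rpow` ∕ `rootLevel_pow_eq` (for `θ·A₀ ≤ Θ`
  the max is the root and its `p₀`-th power is `Θ∕(θ·A₀)` EXACTLY), **`le_theta_mul_rootLevel`** (`Θ ≤ θ·(A₀·x_root^{p₀})`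
  for every `θ, A₀ > 0`, `p₀ ≥ 1`, every `Θ`), **`rootLevel_le_level`** (`x_root ≤ x_Θ` for `0 ≤ Θ`),
  `exp_level_le_exp_rootLevel` (the root threshold dominates the linear one).
* §2 in the letters of S12j: `one_le_rootLevelP`, `hθJ_of_rootLevel`, **`thresholdPaid_of_window_root`**,
  **`thresholdPaid_of_coupling_root`** — the SAME conclusions as `HistoryFlowProfileLevel.thresholdPaid_of_window` ∕
  `_of_coupling` (the triple `1 ≤ P`, `Θ ≤ θ·P`, `hP` verbatim) at `P := C.A₀·x_root^{C.p₀}`, on the window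
  `γ ≤ e^{−x_root∕2}` resp. for couplings `g ≤ e^{−(x_root+1)∕2}` — drop-in for the pinned END's `obtain ⟨hP1, hθJ, hP⟩`.
* §3 the numbers: `theta_mul_levelP_eq` (the linear level pays `θ·P = Θ·(Θ∕(θ·A₀))^{p₀−1}` when `θ·A₀ ≤ Θ`),
  `theta_mul_rootLevelP_eq` (the root level pays `θ·P = Θ` exactly), `level_ge_of_floor` ∕ **`exp_level_le_of_floor`**
  (any floor `Θ₀ ≤ Θ` — e.g. `8·8710^d` from `theta_floor` — puts the linear threshold below `e^{−(Θ₀∕(θ·A₀)+1)∕2}`),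
  and the `d = 4` instance **`exp_level_le_four`** over END v3.1′'s `Θ` VERBATIM: the pinned threshold is at most
  `exp (−(46042893350480000 ∕ (θ·C.A₀) + 1) ∕ 2)`.

HONEST.  Flow-side ∕ real-arithmetic bookkeeping on the cell's OWN window; discharges nothing of H3 ∕ (B) ∕ BetaPertH ∕
NE7c ∕ NE7 ∕ the four rates; the headline's Prop is unchanged (this is a census of its ∃-bound threshold, not a caveat);
NE7b NOT proved; spine PROVED 0∕9.  HONEST DEPENDENCY (cell): continuum YM on T⁴ ⇐ BetaPertH ∧ nine spine estimates
(0/9 proved); BetaPertH ⇐ (D1) ∧ (D4) ∧ CAP+tail; G-an2-4 gates asym, D1 and NE2/3/4.  Unchanged here.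
-/

open Literature.MathematicalPhysics.QuantumFieldTheory.Balaban1983to89
open T4Continuum
open Summit.QuantumFields.BalabanUV.T4Continuum.CountThresholdUniform
open Summit.QuantumFields.BalabanUV.T4Continuum.HistoryFlow
open Summit.QuantumFields.BalabanUV.T4Continuum.HistoryFlowProfileLevel
open Summit.QuantumFields.BalabanUV.T4Continuum.HistoryZoneEvolve (cth)

namespace Summit.QuantumFields.BalabanUV.T4Continuum.HistoryFlowProfileRoot

noncomputable section

/-! ## §1 The p₀-th-root level paying a class-linear constant `Θ` out of a slack `θ` WITHOUT SLACK -/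

section Root

/-- `1 ≤ x_root := max 1 ((Θ∕(θ·A₀))^{1∕p₀})`. [folklore] -/
theorem one_le_rootLevel (θ A₀ Θ : ℝ) (p₀ : ℕ) : 1 ≤ max 1 ((Θ / (θ * A₀)) ^ ((p₀ : ℝ)⁻¹)) := le_max_left _ _

/-- the root level is nonnegative [folklore] -/
theorem rootLevel_nonneg (θ A₀ Θ : ℝ) (p₀ : ℕ) : 0 ≤ max 1 ((Θ / (θ * A₀)) ^ ((p₀ : ℝ)⁻¹)) :=
  zero_le_one.trans (one_le_rootLevel θ A₀ Θ p₀)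

/-- Above the slack (`1 ≤ Θ∕(θ·A₀)`) the root level IS the root. [folklore] -/
theorem rootLevel_eq_rpow {θ A₀ Θ : ℝ} (p₀ : ℕ) (hy : 1 ≤ Θ / (θ * A₀)) :
    max 1 ((Θ / (θ * A₀)) ^ ((p₀ : ℝ)⁻¹)) = (Θ / (θ * A₀)) ^ ((p₀ : ℝ)⁻¹) :=
  max_eq_right (Real.one_le_rpow hy (inv_nonneg.2 (Nat.cast_nonneg p₀)))

/-- **THE ROOT LEVEL IS TIGHT**: above the slack its `p₀`-th power is `Θ∕(θ·A₀)` exactly (`p₀ ≥ 1`). [folklore] -/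
theorem rootLevel_pow_eq {θ A₀ Θ : ℝ} {p₀ : ℕ} (hp₀ : 1 ≤ p₀) (hy : 1 ≤ Θ / (θ * A₀)) :
    (max 1 ((Θ / (θ * A₀)) ^ ((p₀ : ℝ)⁻¹))) ^ p₀ = Θ / (θ * A₀) := by
  rw [rootLevel_eq_rpow p₀ hy]
  exact Real.rpow_inv_natCast_pow (zero_le_one.trans hy) (by omega)

/-- **THE ROOT LEVEL PAYS**: for `θ > 0`, `A₀ > 0`, `p₀ ≥ 1` and every `Θ`, the explicit
`x_root := max 1 ((Θ∕(θ·A₀))^{1∕p₀})` satisfies `Θ ≤ θ·(A₀·x_root^{p₀})` — the companion of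
`HistoryFlowProfileLevel.le_theta_mul_level` with the `p₀`-th power USED rather than discarded. [folklore] -/
theorem le_theta_mul_rootLevel {θ A₀ : ℝ} (hθ : 0 < θ) (hA₀ : 0 < A₀) {p₀ : ℕ} (hp₀ : 1 ≤ p₀) (Θ : ℝ) :
    Θ ≤ θ * (A₀ * (max 1 ((Θ / (θ * A₀)) ^ ((p₀ : ℝ)⁻¹))) ^ p₀) := by
  have hθA : 0 < θ * A₀ := mul_pos hθ hA₀
  rcases le_or_gt 1 (Θ / (θ * A₀)) with hy | hy
  · rw [rootLevel_pow_eq hp₀ hy]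
    have : θ * (A₀ * (Θ / (θ * A₀))) = Θ := by field_simp
    rw [this]
  · have hΘ : Θ ≤ θ * A₀ := by
      have h' : Θ / (θ * A₀) ≤ 1 := hy.le
      rwa [div_le_one hθA] at h'
    have hx1 : 1 ≤ (max 1 ((Θ / (θ * A₀)) ^ ((p₀ : ℝ)⁻¹))) ^ p₀ := one_le_pow₀ (one_le_rootLevel θ A₀ Θ p₀)
    calc Θ ≤ θ * A₀ := hΘ
      _ = θ * (A₀ * 1) := by ring
      _ ≤ θ * (A₀ * (max 1 ((Θ / (θ * A₀)) ^ ((p₀ : ℝ)⁻¹))) ^ p₀) :=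
          mul_le_mul_of_nonneg_left (mul_le_mul_of_nonneg_left hx1 hA₀.le) hθ.le

/-- **THE ROOT LEVEL IS BELOW THE LINEAR LEVEL** (`0 ≤ Θ`, `θ, A₀ > 0`, `p₀ ≥ 1`): `x_root ≤ x_Θ := max 1 (Θ∕(θ·A₀))` —
so the root window `γ ≤ e^{−x_root∕2}` ∕ `g ≤ e^{−(x_root+1)∕2}` CONTAINS the linear one. [folklore] -/
theorem rootLevel_le_level {θ A₀ Θ : ℝ} (hθ : 0 < θ) (hA₀ : 0 < A₀) (hΘ : 0 ≤ Θ) {p₀ : ℕ} (hp₀ : 1 ≤ p₀) :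
    max 1 ((Θ / (θ * A₀)) ^ ((p₀ : ℝ)⁻¹)) ≤ max 1 (Θ / (θ * A₀)) := by
  have hy0 : 0 ≤ Θ / (θ * A₀) := div_nonneg hΘ (mul_pos hθ hA₀).le
  have hinv0 : 0 ≤ ((p₀ : ℝ)⁻¹) := inv_nonneg.2 (Nat.cast_nonneg p₀)
  have hinv1 : ((p₀ : ℝ)⁻¹) ≤ 1 := inv_le_one_of_one_le₀ (by exact_mod_cast hp₀)
  rcases le_or_gt 1 (Θ / (θ * A₀)) with hy | hy
  · calc max 1 ((Θ / (θ * A₀)) ^ ((p₀ : ℝ)⁻¹)) = (Θ / (θ * A₀)) ^ ((p₀ : ℝ)⁻¹) := rootLevel_eq_rpow p₀ hy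
      _ ≤ Θ / (θ * A₀) := Real.rpow_le_self_of_one_le hy hinv1
      _ ≤ max 1 (Θ / (θ * A₀)) := le_max_right _ _
  · have h1 : (Θ / (θ * A₀)) ^ ((p₀ : ℝ)⁻¹) ≤ 1 := Real.rpow_le_one hy0 hy.le hinv0
    calc max 1 ((Θ / (θ * A₀)) ^ ((p₀ : ℝ)⁻¹)) = 1 := max_eq_left h1
      _ ≤ max 1 (Θ / (θ * A₀)) := le_max_left _ _

/-- **THE ROOT THRESHOLD DOMINATES THE LINEAR ONE**: `e^{−(x_Θ+1)∕2} ≤ e^{−(x_root+1)∕2}` (and the same without the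
margin `1`). [folklore] -/
theorem exp_level_le_exp_rootLevel {θ A₀ Θ : ℝ} (hθ : 0 < θ) (hA₀ : 0 < A₀) (hΘ : 0 ≤ Θ) {p₀ : ℕ} (hp₀ : 1 ≤ p₀)
    (c : ℝ) :
    Real.exp (-((max 1 (Θ / (θ * A₀)) + c) / 2)) ≤
      Real.exp (-((max 1 ((Θ / (θ * A₀)) ^ ((p₀ : ℝ)⁻¹)) + c) / 2)) := by
  have := rootLevel_le_level hθ hA₀ hΘ hp₀
  exact Real.exp_le_exp.2 (by linarith)

end Root

/-! ## §2 In the letters of the repair row S12j — drop-in companions of `thresholdPaid_of_window` ∕ `_of_coupling` -/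

section Letters

variable {F : T4Family} {G : Type*} [GaugeGroup G] [MeasurableSpace G] [HaarData G]
variable {C : T4PrintedShapeBanking.Consts} {rr : ℕ} {β₀ : ℝ}

/-- `1 ≤ P := C.A₀·x_root^{C.p₀}` for `1 ≤ C.A₀`. [folklore] -/
theorem one_le_rootLevelP (hA₀ : 1 ≤ C.A₀) (θ Θ : ℝ) :
    1 ≤ C.A₀ * (max 1 ((Θ / (θ * C.A₀)) ^ ((C.p₀ : ℝ)⁻¹))) ^ C.p₀ :=
  one_le_levelP hA₀ (one_le_rootLevel θ C.A₀ Θ C.p₀)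

/-- **`hθJ` AT THE ROOT LEVEL** — `Θ ≤ θ·P` at `P := C.A₀·x_root^{C.p₀}`, for EVERY `θ > 0` and EVERY `Θ`
(`1 ≤ C.p₀` and `0 < C.A₀` from `ThresholdOK`). [folklore] -/
theorem hθJ_of_rootLevel {L : ℕ} (h : ThresholdOK C L rr β₀) {θ : ℝ} (hθ : 0 < θ) (Θ : ℝ) :
    Θ ≤ θ * (C.A₀ * (max 1 ((Θ / (θ * C.A₀)) ^ ((C.p₀ : ℝ)⁻¹))) ^ C.p₀) :=
  le_theta_mul_rootLevel hθ h.A₀_pos (one_le_p₀ h) Θ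

/-- **THE PAIR (`hP`, `hθJ`) INHABITED ON THE ROOT WINDOW, FOR EVERY POSITIVE SLACK** — as
`HistoryFlowProfileLevel.thresholdPaid_of_window` with the level `x_root := max 1 ((Θ∕(θ·C.A₀))^{1∕C.p₀})`: `1 ≤ P`,
`Θ ≤ θ·P`, and the S12j binder `hP` VERBATIM at `P := C.A₀·x_root^{C.p₀}` along every sequence of runs tuned inside
`γ ≤ e^{−x_root∕2}`. [folklore] -/
theorem thresholdPaid_of_window_root (D : FiniteEpsData F G) (h : ThresholdOK C F.L rr β₀) (hA₀ : 1 ≤ C.A₀) {θ : ℝ}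
    (hθ : 0 < θ) (Θ : ℝ) {γ g : ℝ} {g₀ : ℕ → ℝ} (ht : D.Tuned γ g g₀)
    (hγx : γ ≤ Real.exp (-(max 1 ((Θ / (θ * C.A₀)) ^ ((C.p₀ : ℝ)⁻¹)) / 2))) (K₀ : ℕ) :
    1 ≤ C.A₀ * (max 1 ((Θ / (θ * C.A₀)) ^ ((C.p₀ : ℝ)⁻¹))) ^ C.p₀ ∧
      Θ ≤ θ * (C.A₀ * (max 1 ((Θ / (θ * C.A₀)) ^ ((C.p₀ : ℝ)⁻¹))) ^ C.p₀) ∧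
      ∀ K, K₀ ≤ K → ∀ s ≤ K,
        C.A₀ * (max 1 ((Θ / (θ * C.A₀)) ^ ((C.p₀ : ℝ)⁻¹))) ^ C.p₀ ≤
          p0Profile C.A₀ C.p₀ ((D.C ⟨K, F.m, g₀ K⟩).flow.g s) :=
  ⟨one_le_rootLevelP hA₀ θ Θ, hθJ_of_rootLevel h hθ Θ,
    hP_of_window D h ht (rootLevel_nonneg θ C.A₀ Θ C.p₀) hγx K₀⟩

/-- **THE PAIR (`hP`, `hθJ`) INHABITED BELOW THE ROOT COUPLING THRESHOLD, FOR EVERY POSITIVE SLACK** — as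
`HistoryFlowProfileLevel.thresholdPaid_of_coupling` with the level `x_root`: the demand on the renormalised coupling is
`g ≤ e^{−(x_root+1)∕2}` (route §2 of leaf-05 gen 6: the flow side the ENDs hold, `β₀ ≤ ½`). [folklore] -/
theorem thresholdPaid_of_coupling_root (D : FiniteEpsData F G) (h : ThresholdOK C F.L rr β₀) (hA₀ : 1 ≤ C.A₀) {θ : ℝ}
    (hθ : 0 < θ) (Θ : ℝ) {γ₀ γ b β' g : ℝ} {p : ℕ} (hb : 0 ≤ b) (hlo : FlowStep.BetaLowerH b γ₀ D.βfun)
    (hhi : FlowStep.BetaUpperH β' γ₀ D.βfun) (hγ : γ ≤ γ₀) (hγβ : γ ^ 2 * β' < 1)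
    (S : B14FlowStep.SmallnessFor γ β' β₀ F.L p) (hβ : β₀ ≤ 1 / 2) {g₀ : ℕ → ℝ} (ht : D.Tuned γ g g₀) (hg : 0 < g)
    (hle : g ≤ Real.exp (-((max 1 ((Θ / (θ * C.A₀)) ^ ((C.p₀ : ℝ)⁻¹)) + 1) / 2))) (K₀ : ℕ) :
    1 ≤ C.A₀ * (max 1 ((Θ / (θ * C.A₀)) ^ ((C.p₀ : ℝ)⁻¹))) ^ C.p₀ ∧
      Θ ≤ θ * (C.A₀ * (max 1 ((Θ / (θ * C.A₀)) ^ ((C.p₀ : ℝ)⁻¹))) ^ C.p₀) ∧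
      ∀ K, K₀ ≤ K → ∀ s ≤ K,
        C.A₀ * (max 1 ((Θ / (θ * C.A₀)) ^ ((C.p₀ : ℝ)⁻¹))) ^ C.p₀ ≤
          p0Profile C.A₀ C.p₀ ((D.C ⟨K, F.m, g₀ K⟩).flow.g s) :=
  ⟨one_le_rootLevelP hA₀ θ Θ, hθJ_of_rootLevel h hθ Θ,
    hP_of_coupling D h hb hlo hhi hγ hγβ S hβ ht (rootLevel_nonneg θ C.A₀ Θ C.p₀)
      (le_log_inv_sq_of_le_exp hg hle) K₀⟩

/-- The pinned END's window form survives the change of level: a window below the LINEAR threshold is below the ROOT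
threshold (`0 ≤ Θ`), so `thresholdPaid_of_coupling_root` applies wherever `thresholdPaid_of_coupling` was applied.
[folklore] -/
theorem le_exp_rootLevel_of_le_exp_level {L : ℕ} (h : ThresholdOK C L rr β₀) {θ : ℝ} (hθ : 0 < θ) {Θ : ℝ}
    (hΘ : 0 ≤ Θ) {g : ℝ} (hle : g ≤ Real.exp (-((max 1 (Θ / (θ * C.A₀)) + 1) / 2))) :
    g ≤ Real.exp (-((max 1 ((Θ / (θ * C.A₀)) ^ ((C.p₀ : ℝ)⁻¹)) + 1) / 2)) :=
  hle.trans (exp_level_le_exp_rootLevel hθ h.A₀_pos hΘ (one_le_p₀ h) 1)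

end Letters

/-! ## §3 The numbers: what each level pays, and where the linear threshold sits -/

section Numbers

/-- **THE LINEAR LEVEL OVERPAYS**: above the slack (`θ·A₀ ≤ Θ`, `θ, A₀ > 0`) the linear level `x_Θ = Θ∕(θ·A₀)` pays
`θ·(A₀·x_Θ^{p₀}) = Θ·(Θ∕(θ·A₀))^{p₀−1}` for the demand `Θ` (`p₀ ≥ 1`). [folklore] -/
theorem theta_mul_levelP_eq {θ A₀ Θ : ℝ} (hθ : 0 < θ) (hA₀ : 0 < A₀) {p₀ : ℕ} (hp₀ : 1 ≤ p₀)
    (hy : 1 ≤ Θ / (θ * A₀)) :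
    θ * (A₀ * (max 1 (Θ / (θ * A₀))) ^ p₀) = Θ * (Θ / (θ * A₀)) ^ (p₀ - 1) := by
  rw [max_eq_right hy]
  obtain ⟨k, rfl⟩ := Nat.exists_eq_add_of_le hp₀
  rw [Nat.add_sub_cancel_left, pow_add, pow_one]
  have hθA : θ * A₀ ≠ 0 := (mul_pos hθ hA₀).ne'
  field_simp

/-- **THE ROOT LEVEL PAYS EXACTLY**: above the slack the root level pays `θ·(A₀·x_root^{p₀}) = Θ`. [folklore] -/
theorem theta_mul_rootLevelP_eq {θ A₀ Θ : ℝ} (hθ : 0 < θ) (hA₀ : 0 < A₀) {p₀ : ℕ} (hp₀ : 1 ≤ p₀)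
    (hy : 1 ≤ Θ / (θ * A₀)) :
    θ * (A₀ * (max 1 ((Θ / (θ * A₀)) ^ ((p₀ : ℝ)⁻¹))) ^ p₀) = Θ := by
  rw [rootLevel_pow_eq hp₀ hy]
  have hθA : θ * A₀ ≠ 0 := (mul_pos hθ hA₀).ne'
  field_simp

/-- Any floor `Θ₀ ≤ Θ` is a floor of the linear level: `Θ₀∕(θ·A₀) ≤ x_Θ` (`θ, A₀ > 0`). [folklore] -/
theorem level_ge_of_floor {θ A₀ Θ Θ₀ : ℝ} (hθ : 0 < θ) (hA₀ : 0 < A₀) (hfloor : Θ₀ ≤ Θ) :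
    Θ₀ / (θ * A₀) ≤ max 1 (Θ / (θ * A₀)) :=
  (div_le_div_of_nonneg_right hfloor (mul_pos hθ hA₀).le).trans (le_max_right _ _)

/-- **WHERE THE LINEAR THRESHOLD SITS**: any floor `Θ₀ ≤ Θ` puts the linear coupling threshold `e^{−(x_Θ+1)∕2}` below
`e^{−(Θ₀∕(θ·A₀)+1)∕2}`. [folklore] -/
theorem exp_level_le_of_floor {θ A₀ Θ Θ₀ : ℝ} (hθ : 0 < θ) (hA₀ : 0 < A₀) (hfloor : Θ₀ ≤ Θ) :
    Real.exp (-((max 1 (Θ / (θ * A₀)) + 1) / 2)) ≤ Real.exp (-((Θ₀ / (θ * A₀) + 1) / 2)) := by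
  have := level_ge_of_floor hθ hA₀ hfloor
  exact Real.exp_le_exp.2 (by linarith)

variable {C : T4PrintedShapeBanking.Consts} {rr : ℕ} {β₀ : ℝ}

/-- **THE PINNED THRESHOLD OF RECORD, LOCATED** (any dimension): with END v3.1′'s `Θ` — the left side of its `hθJ`,
VERBATIM — the linear coupling threshold `exp (−(max 1 (Θ∕(θ·C.A₀)) + 1)∕2)` of the pinned END
`HistoryRealiseCellsRunPinnedT3bP.hybridNE7_of_realisedDomainsRun_pinnedT3bPD` is at most
`exp (−(8·8710^d∕(θ·C.A₀) + 1)∕2)` (`HistoryConstantsSlackT3b.theta_floor`, `0 ≤ θc < 1`, `1 ≤ sS`, `θ > 0`, `ThresholdOK`).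
[folklore] -/
theorem exp_level_le_of_END31 {L : ℕ} (h : ThresholdOK C L rr β₀) {θ : ℝ} (hθ : 0 < θ) {d sS : ℕ} {θc : ℝ}
    (hθc0 : 0 ≤ θc) (hθc1 : θc < 1) (hsS : 1 ≤ sS) :
    Real.exp (-((max 1 (((2 +
            ((2 * (((2 * cth 32 1 sS + 1) ^ d : ℕ) : ℝ) * ((((2 * 32 + 1) ^ d : ℕ) : ℝ) * (4 * 2 ^ d)) +
                  4 * ((((2 * cth 32 1 sS + 1) ^ d : ℕ) : ℝ) * (5 : ℝ) ^ d)) / (1 - θc) +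
              2 * (2 * ((((2 * cth 32 1 sS + 1) ^ d : ℕ) : ℝ) * (5 : ℝ) ^ d))) +
            (2 * ((0 + 2 * Real.log (2 * d + 1)) + (2 * (d : ℝ) + 2 * Real.log (2 * d + 1)) *
                  (((max 1 (2 * 32 + 2) : ℕ) : ℝ) * (2 * ((((2 * cth 32 1 sS + 1) ^ d : ℕ) : ℝ) * (5 : ℝ) ^ d)))) +
              (2 * (d : ℝ) + 2 * Real.log (2 * d + 1)) * 1 *
                (((max 1 (2 * 32 + 2) : ℕ) : ℝ) *
                    ((2 * (((2 * cth 32 1 sS + 1) ^ d : ℕ) : ℝ) * ((((2 * 32 + 1) ^ d : ℕ) : ℝ) * (4 * 2 ^ d)) +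
                        4 * ((((2 * cth 32 1 sS + 1) ^ d : ℕ) : ℝ) * (5 : ℝ) ^ d)) / (1 - θc)) +
                  4 * 2 ^ d)) +
            10) + 8 * 2 ^ d * Real.log (2 * d + 1)) / (θ * C.A₀)) + 1) / 2)) ≤
      Real.exp (-(((8 : ℝ) * 8710 ^ d / (θ * C.A₀) + 1) / 2)) :=
  exp_level_le_of_floor hθ h.A₀_pos (HistoryConstantsSlackT3b.theta_floor hθc0 hθc1 hsS le_rfl)

/-- **ON T⁴ (`d = 4`)**: the pinned END's linear coupling threshold is at most
`exp (−(46 042 893 350 480 000∕(θ·C.A₀) + 1)∕2)` (`46042893350480000 = 8·8710⁴`). [folklore] -/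
theorem exp_level_le_four {L : ℕ} (h : ThresholdOK C L rr β₀) {θ : ℝ} (hθ : 0 < θ) {sS : ℕ} {θc : ℝ}
    (hθc0 : 0 ≤ θc) (hθc1 : θc < 1) (hsS : 1 ≤ sS) :
    Real.exp (-((max 1 (((2 +
            ((2 * (((2 * cth 32 1 sS + 1) ^ 4 : ℕ) : ℝ) * ((((2 * 32 + 1) ^ 4 : ℕ) : ℝ) * (4 * 2 ^ 4)) +
                  4 * ((((2 * cth 32 1 sS + 1) ^ 4 : ℕ) : ℝ) * (5 : ℝ) ^ 4)) / (1 - θc) +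
              2 * (2 * ((((2 * cth 32 1 sS + 1) ^ 4 : ℕ) : ℝ) * (5 : ℝ) ^ 4))) +
            (2 * ((0 + 2 * Real.log (2 * (4 : ℕ) + 1)) + (2 * ((4 : ℕ) : ℝ) + 2 * Real.log (2 * (4 : ℕ) + 1)) *
                  (((max 1 (2 * 32 + 2) : ℕ) : ℝ) * (2 * ((((2 * cth 32 1 sS + 1) ^ 4 : ℕ) : ℝ) * (5 : ℝ) ^ 4)))) +
              (2 * ((4 : ℕ) : ℝ) + 2 * Real.log (2 * (4 : ℕ) + 1)) * 1 *
                (((max 1 (2 * 32 + 2) : ℕ) : ℝ) *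
                    ((2 * (((2 * cth 32 1 sS + 1) ^ 4 : ℕ) : ℝ) * ((((2 * 32 + 1) ^ 4 : ℕ) : ℝ) * (4 * 2 ^ 4)) +
                        4 * ((((2 * cth 32 1 sS + 1) ^ 4 : ℕ) : ℝ) * (5 : ℝ) ^ 4)) / (1 - θc)) +
                  4 * 2 ^ 4)) +
            10) + 8 * 2 ^ 4 * Real.log (2 * (4 : ℕ) + 1)) / (θ * C.A₀)) + 1) / 2)) ≤
      Real.exp (-(((46042893350480000 : ℝ) / (θ * C.A₀) + 1) / 2)) := by
  have h8 : (8 : ℝ) * 8710 ^ 4 = 46042893350480000 := by norm_num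
  rw [← h8]
  exact exp_level_le_of_END31 (d := 4) h hθ hθc0 hθc1 hsS

end Numbers

end

end Summit.QuantumFields.BalabanUV.T4Continuum.HistoryFlowProfileRoot
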